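import Summits.HodgeConjecture.CorCM.Census.CentralSquaresPartnersLocal
import Summits.HodgeConjecture.CorCM.Census.CentralSquaresPartnersMixedLawCounts

/-!
# The square-central class, LXIV: the multi-partner laws from FAR COUNTS ONLY (local ties)

COR-CM (cell `pub-hodgecm2`), count-neutral kernel combinatorics by the binder seat b09 (gen 50; lane SQUARE-CENTRAL CLASS, part LXIV), on part LXIII (the relation
families from local ties), parts LVII–LVIII (`tie_of_inter_bounds`, `tieC_of_inter_bounds`, `far_of_inter_bounds`), parts XLIX, LX (the residual closures), LI,
LXI, LXII (`hbase_exchange_partners`, `card_sdiff_exchange_partners`, `pair_exchange_partners`, `cover_frame`), BY NAME.  Theorems only: no definition, no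
`decide`, no certificate, no named fact, no `sorry`.  HONEST FRAMING: `HC_CM` is NOT proved, here or anywhere in the tree; nothing here is a period or a headline.

THE POINT.  With local ties (part LXIII) the only combinatorial input per partner is the FAR COUNT `3 ≤ |T ∩ 𝓗'| ≤ m − 3` (and the three exchanged /
companion counts) for the CHOSEN transversals `T`, `T'`: the ties at the transversals within one swap of them follow (`inter_bounds_of_near`).  So the
all-dihedral law and the mixed law hold with part LIXʼs / LXIIʼs count hypotheses MINUS the global tie counts (`…_dihedral_of_far_counts`,
`…_mixed_of_far_counts`) — the form that is non-vacuous for the rank-two block of Pauli `× E` (`m ≥ 8`), where the indirect partnerʼs swaps have three-way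
ties at some transversals but the chosen one meets every other partner set in `m/2` places.

## References
* [Pohlmann1968] H. Pohlmann, Algebraic cycles on abelian varieties of complex multiplication type, Ann. of Math. 88 (1968), Thm 1.
* [Milne1999] J. S. Milne, Lefschetz motives and the Tate conjecture, Compositio Math. 117 (1999), Prop. 2.1, p. 54.
-/

namespace Summit.HodgeConjecture.CorCM.Census.CentralSquares

open Finset
open scoped symmDiff
open Summit.HodgeConjecture.CorCM.Prior.AllgGroup.RfwfAllgGroup
open Summit.HodgeConjecture.CorCM.Census.BlockParity
open Summit.HodgeConjecture.CorCM.Census.Coinvariant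
open Summit.HodgeConjecture.CorCM.Census.TwistGeneration
open Summit.HodgeConjecture.CorCM.Census.BaseBlock
open Summit.HodgeConjecture.CorCM.Census.CoverClosure

noncomputable section

variable {G : Type*} [Group G] [Fintype G] [DecidableEq G] (c : G)

/-! ## §1 Counts near a transversal -/

omit [Group G] [Fintype G] in
/-- If `|T| = |U|`, `|U ∖ T| ≤ 1` and `3 ≤ |T ∩ H| ≤ m − 3` then `0 < |U ∩ H| < m`. [folklore] -/
theorem inter_bounds_of_near (T U H : Finset G) (m : ℕ) (hTU : T.card = U.card) (hnear : (U \ T).card ≤ 1)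
    (hlo : 3 ≤ (T ∩ H).card) (hhi : (T ∩ H).card + 3 ≤ m) : 0 < (U ∩ H).card ∧ (U ∩ H).card < m := by
  have hTU' : (T \ U).card = (U \ T).card := by
    have h1 := card_sdiff_add_card_inter T U
    have h2 := card_sdiff_add_card_inter U T
    rw [inter_comm] at h2
    omega
  have hlow : (T ∩ H).card ≤ (U ∩ H).card + (T \ U).card := by
    calc (T ∩ H).card ≤ ((U ∩ H) ∪ (T \ U)).card := card_le_card fun x hx => by
            obtain ⟨hxT, hxH⟩ := mem_inter.mp hx
            by_cases hxU : x ∈ U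
            · exact mem_union_left _ (mem_inter.mpr ⟨hxU, hxH⟩)
            · exact mem_union_right _ (mem_sdiff.mpr ⟨hxT, hxU⟩)
      _ ≤ (U ∩ H).card + (T \ U).card := card_union_le _ _
  have hup : (U ∩ H).card ≤ (T ∩ H).card + (U \ T).card := by
    calc (U ∩ H).card ≤ ((T ∩ H) ∪ (U \ T)).card := card_le_card fun x hx => by
            obtain ⟨hxU, hxH⟩ := mem_inter.mp hx
            by_cases hxT : x ∈ T
            · exact mem_union_left _ (mem_inter.mpr ⟨hxT, hxH⟩)
            · exact mem_union_right _ (mem_sdiff.mpr ⟨hxU, hxT⟩)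
      _ ≤ (T ∩ H).card + (U \ T).card := card_union_le _ _
  omega

/-! ## §2 The four families at a dihedral-type partner from far counts (any base type) -/

/-- **`Rᶜ(T')` from a local tie** (part LIIʼs `relc_mem_partners` with the tie only at the type of `T'`). [folklore] -/
theorem relc_mem_partners_local (hc2 : c * c = 1) (hcen : ∀ x : G, x * c = c * x) (T₀ : CMF G c) (𝒯 : Finset (CMF G c))
    (hbase : ∀ Q : G, rt c Q T₀ = T₀ ∨ rt c Q T₀ = rt c c T₀ ∨ ∃ T₁ ∈ 𝒯, rt c Q T₀ = T₁ ∨ rt c Q T₀ = rt c c T₁)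
    (m : ℕ) (hn : T₀.1.card = 4 * m) (hH : ∀ T₁ ∈ 𝒯, (T₀.1 \ T₁.1).card = 2 * m)
    (hpair : ∀ T₁ ∈ 𝒯, ∀ T₂ ∈ 𝒯, T₁ ≠ T₂ → ((T₀.1 \ T₁.1) ∆ (T₀.1 \ T₂.1)).card = 2 * m)
    (T₁ : CMF G c) (hT₁ : T₁ ∈ 𝒯) (Q : G) (hQ : rt c Q T₀ = T₁) (hQQ : Q * Q = 1)
    (hσH : ∀ t ∈ T₀.1, ∀ t' ∈ T₀.1, (t' = t * Q ∨ t' = c * (t * Q)) → (t ∈ T₀.1 \ T₁.1 ↔ t' ∈ T₀.1 \ T₁.1))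
    (L : Submodule ℤ (CMF G c →₀ ℤ)) (hLrt : ∀ (Q' : G) (y : CMF G c →₀ ℤ), y ∈ L → Finsupp.mapDomain (rt c Q') y ∈ L)
    (hP : ∀ Ψ : CMF G c, pair c Ψ ∈ L)
    (hcover : ∀ Ψ : CMF G c, 2 ≤ bpot c T₀ Ψ → ∃ Q₂ s s' : G, bpot c T₀ Ψ = ddist (rt c Q₂ T₀) Ψ ∧
      s ∈ (rt c Q₂ T₀).1 \ Ψ.1 ∧ s' ∈ (rt c Q₂ T₀).1 \ Ψ.1 ∧ s ≠ s' ∧ gface c hc2 Ψ s s' ∈ L ∧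
      ((∃ Q₁ t t' : G, bpot c T₀ Ψ = ddist (rt c Q₁ T₀) Ψ ∧ t ∈ (rt c Q₁ T₀).1 \ Ψ.1 ∧ t' ∈ (rt c Q₁ T₀).1 \ Ψ.1 ∧ t ≠ t' ∧
          (∀ Q' : G, ddist (rt c Q' T₀) (oflipCM c hc2 t Ψ) = bpot c T₀ (oflipCM c hc2 t Ψ) → rt c Q' T₀ = rt c Q₁ T₀) ∧
          (∀ Q' : G, ddist (rt c Q' T₀) (oflipCM c hc2 t' Ψ) = bpot c T₀ (oflipCM c hc2 t' Ψ) → rt c Q' T₀ = rt c Q₁ T₀) ∧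
          (∀ Q' : G, ddist (rt c Q' T₀) (oflipCM c hc2 t (oflipCM c hc2 t' Ψ)) = bpot c T₀ (oflipCM c hc2 t (oflipCM c hc2 t' Ψ)) →
            rt c Q' T₀ = rt c Q₁ T₀)) →
        (∀ Q' : G, ddist (rt c Q' T₀) (oflipCM c hc2 s Ψ) = bpot c T₀ (oflipCM c hc2 s Ψ) → rt c Q' T₀ = rt c Q₂ T₀) ∧
        (∀ Q' : G, ddist (rt c Q' T₀) (oflipCM c hc2 s' Ψ) = bpot c T₀ (oflipCM c hc2 s' Ψ) → rt c Q' T₀ = rt c Q₂ T₀) ∧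
        (∀ Q' : G, ddist (rt c Q' T₀) (oflipCM c hc2 s (oflipCM c hc2 s' Ψ)) = bpot c T₀ (oflipCM c hc2 s (oflipCM c hc2 s' Ψ)) →
          rt c Q' T₀ = rt c Q₂ T₀)))
    (hm : 2 ≤ m) (T' : Finset G) (hTH : T' ⊆ T₀.1 ∩ T₁.1) (hTm : T'.card = m)
    (hT : ∀ t ∈ T₀.1 ∩ T₁.1, ∀ t' ∈ T₀.1, (t' = t * Q ∨ t' = c * (t * Q)) → (t ∈ T' ↔ t' ∉ T'))
    (htieT' : ∀ X : CMF G c, T₀.1 \ X.1 = T' → ∀ Q' : G, ddist (rt c Q' T₀) X = m → rt c Q' T₀ = T₀ ∨ rt c Q' T₀ = rt c c T₁) :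
    ∃ T' : Finset G, T' ⊆ T₀.1 ∩ T₁.1 ∧ T'.card = m ∧
      ∑ s ∈ T', Finsupp.single (oflipCM c hc2 s T₀) (1 : ℤ) + ∑ u ∈ (T₀.1 ∩ T₁.1) \ T', Finsupp.single (oflipCM c hc2 u T₁) (1 : ℤ) -
        ((m : ℤ) - 1) • (Finsupp.single T₀ (1 : ℤ) + Finsupp.single T₁ 1) ∈ L := by
  classical
  -- part LII's proof reads `htiesC` only at `T'`: supply a global-looking hypothesis that is `htieT'` at `T'` and vacuous use elsewhere is never made —
  -- we re-run the companion-frame argument directly.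
  refine ⟨T', hTH, hTm, ?_⟩
  have hHc : T₀.1 \ (rt c c T₁).1 = T₀.1 ∩ T₁.1 := by
    rw [dev_compl c hcen T₀ T₁]; ext t; simp only [mem_sdiff, mem_inter, not_and, not_not]; tauto
  have hT2 : ∀ t ∈ T₀.1 \ (rt c c T₁).1, ∀ t' ∈ T₀.1, (t' = t * (c * Q) ∨ t' = c * (t * (c * Q))) → (t ∈ T' ↔ t' ∉ T') := by
    intro t ht t' ht' h
    rw [or_companion_iff c hc2 hcen Q] at h
    rw [hHc] at ht
    exact hT t ht t' ht' h
  have h := rel_transversal_mem_partners c hc2 hcen T₀ (insert (rt c c T₁) (𝒯.erase T₁)) (companion_base_partners c hc2 hbase) m hn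
    (companion_card_partners c hcen T₀ 𝒯 m hn hH hT₁) (companion_pair_partners c hcen T₀ 𝒯 m hn hpair hT₁) (rt c c T₁) (mem_insert_self _ _)
    (c * Q) (companion_rt c T₀ T₁ Q hQ) (companion_sq c hc2 hcen Q hQQ) L hLrt hcover hm (companion_swap c hc2 hcen T₀ T₁ Q hσH)
    T' (by rw [hHc]; exact hTH) hTm hT2 htieT'
  rw [hHc] at h
  have hsr : ∀ X : CMF G c, Finsupp.single (rt c c X) (1 : ℤ) = pair c X - Finsupp.single X 1 := fun X => by
    rw [pair, add_sub_cancel_left]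
  simp only [oflipCM_rt_self c hc2 hcen, hsr] at h
  have hp1 : ∑ u ∈ (T₀.1 ∩ T₁.1) \ T', pair c (oflipCM c hc2 u T₁) ∈ L := Submodule.sum_mem _ fun u _ => hP _
  have hp2 : ((m : ℤ) - 1) • pair c T₁ ∈ L := Submodule.smul_mem _ _ (hP T₁)
  have hsum : ∑ u ∈ (T₀.1 ∩ T₁.1) \ T', (pair c (oflipCM c hc2 u T₁) - Finsupp.single (oflipCM c hc2 u T₁) (1 : ℤ)) =
      ∑ u ∈ (T₀.1 ∩ T₁.1) \ T', pair c (oflipCM c hc2 u T₁) - ∑ u ∈ (T₀.1 ∩ T₁.1) \ T', Finsupp.single (oflipCM c hc2 u T₁) (1 : ℤ) :=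
    sum_sub_distrib _ _
  rw [hsum] at h
  have e : ∑ s ∈ T', Finsupp.single (oflipCM c hc2 s T₀) (1 : ℤ) + ∑ u ∈ (T₀.1 ∩ T₁.1) \ T', Finsupp.single (oflipCM c hc2 u T₁) (1 : ℤ) -
      ((m : ℤ) - 1) • (Finsupp.single T₀ (1 : ℤ) + Finsupp.single T₁ 1) =
      (∑ s ∈ T', Finsupp.single (oflipCM c hc2 s T₀) (1 : ℤ) -
        (∑ u ∈ (T₀.1 ∩ T₁.1) \ T', pair c (oflipCM c hc2 u T₁) - ∑ u ∈ (T₀.1 ∩ T₁.1) \ T', Finsupp.single (oflipCM c hc2 u T₁) (1 : ℤ)) -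
        ((m : ℤ) - 1) • (Finsupp.single T₀ (1 : ℤ) - (pair c T₁ - Finsupp.single T₁ 1))) +
      ∑ u ∈ (T₀.1 ∩ T₁.1) \ T', pair c (oflipCM c hc2 u T₁) - ((m : ℤ) - 1) • pair c T₁ := by module
  rw [e]
  exact Submodule.sub_mem _ (Submodule.add_mem _ h hp1) hp2

/-- **THE FOUR FAMILIES AT A DIHEDRAL-TYPE PARTNER FROM FAR COUNTS** (any base type `B` with partner set `𝒮`, partner `P`, swap `Q`, transversals `T`, `T'`,
a base-change stable `L ⊇ ℤ⟨pairs⟩` holding a strict lowering cover of `B`): `2Y_s`, `2Y'_a` for all `s`, `a`, one `R(T)`, one `Rᶜ(T')`. [folklore] -/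
theorem partner_families_of_far_counts (hc2 : c * c = 1) (hcen : ∀ x : G, x * c = c * x) (B : CMF G c) (𝒮 : Finset (CMF G c))
    (hbase : ∀ Q : G, rt c Q B = B ∨ rt c Q B = rt c c B ∨ ∃ P ∈ 𝒮, rt c Q B = P ∨ rt c Q B = rt c c P)
    (m : ℕ) (hm : 3 ≤ m) (hn : B.1.card = 4 * m) (hH : ∀ P ∈ 𝒮, (B.1 \ P.1).card = 2 * m)
    (hpair : ∀ P ∈ 𝒮, ∀ P' ∈ 𝒮, P ≠ P' → ((B.1 \ P.1) ∆ (B.1 \ P'.1)).card = 2 * m)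
    {P : CMF G c} (hP𝒮 : P ∈ 𝒮) (Q : G) (hQ : rt c Q B = P) (hQQ : Q * Q = 1)
    (hσH : ∀ t ∈ B.1, ∀ t' ∈ B.1, (t' = t * Q ∨ t' = c * (t * Q)) → (t ∈ B.1 \ P.1 ↔ t' ∈ B.1 \ P.1))
    (T T' : Finset G) (hTH : T ⊆ B.1 \ P.1) (hTm : T.card = m)
    (hT : ∀ t ∈ B.1 \ P.1, ∀ t' ∈ B.1, (t' = t * Q ∨ t' = c * (t * Q)) → (t ∈ T ↔ t' ∉ T))
    (hTH' : T' ⊆ B.1 ∩ P.1) (hTm' : T'.card = m)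
    (hT' : ∀ t ∈ B.1 ∩ P.1, ∀ t' ∈ B.1, (t' = t * Q ∨ t' = c * (t * Q)) → (t ∈ T' ↔ t' ∉ T'))
    (hcfar : ∀ P₂ ∈ 𝒮, P₂ ≠ P →
      (3 ≤ (T ∩ (B.1 \ P₂.1)).card ∧ (T ∩ (B.1 \ P₂.1)).card + 3 ≤ m) ∧
      (3 ≤ (((B.1 \ P.1) \ T).image (fun x => c * x) ∩ (P.1 \ P₂.1)).card ∧
        (((B.1 \ P.1) \ T).image (fun x => c * x) ∩ (P.1 \ P₂.1)).card + 3 ≤ m) ∧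
      (3 ≤ (T' ∩ (B.1 \ P₂.1)).card ∧ (T' ∩ (B.1 \ P₂.1)).card + 3 ≤ m) ∧
      (3 ≤ (((B.1 \ (rt c c P).1) \ T').image (fun x => c * x) ∩ ((rt c c P).1 \ P₂.1)).card ∧
        (((B.1 \ (rt c c P).1) \ T').image (fun x => c * x) ∩ ((rt c c P).1 \ P₂.1)).card + 3 ≤ m))
    (L : Submodule ℤ (CMF G c →₀ ℤ)) (hLrt : ∀ (Q' : G) (y : CMF G c →₀ ℤ), y ∈ L → Finsupp.mapDomain (rt c Q') y ∈ L)
    (hPr : ∀ Ψ : CMF G c, pair c Ψ ∈ L)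
    (hcover : ∀ Ψ : CMF G c, 2 ≤ bpot c B Ψ → ∃ Q₂ s s' : G, bpot c B Ψ = ddist (rt c Q₂ B) Ψ ∧
      s ∈ (rt c Q₂ B).1 \ Ψ.1 ∧ s' ∈ (rt c Q₂ B).1 \ Ψ.1 ∧ s ≠ s' ∧ gface c hc2 Ψ s s' ∈ L ∧
      ((∃ Q₁ t t' : G, bpot c B Ψ = ddist (rt c Q₁ B) Ψ ∧ t ∈ (rt c Q₁ B).1 \ Ψ.1 ∧ t' ∈ (rt c Q₁ B).1 \ Ψ.1 ∧ t ≠ t' ∧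
          (∀ Q' : G, ddist (rt c Q' B) (oflipCM c hc2 t Ψ) = bpot c B (oflipCM c hc2 t Ψ) → rt c Q' B = rt c Q₁ B) ∧
          (∀ Q' : G, ddist (rt c Q' B) (oflipCM c hc2 t' Ψ) = bpot c B (oflipCM c hc2 t' Ψ) → rt c Q' B = rt c Q₁ B) ∧
          (∀ Q' : G, ddist (rt c Q' B) (oflipCM c hc2 t (oflipCM c hc2 t' Ψ)) = bpot c B (oflipCM c hc2 t (oflipCM c hc2 t' Ψ)) →
            rt c Q' B = rt c Q₁ B)) →
        (∀ Q' : G, ddist (rt c Q' B) (oflipCM c hc2 s Ψ) = bpot c B (oflipCM c hc2 s Ψ) → rt c Q' B = rt c Q₂ B) ∧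
        (∀ Q' : G, ddist (rt c Q' B) (oflipCM c hc2 s' Ψ) = bpot c B (oflipCM c hc2 s' Ψ) → rt c Q' B = rt c Q₂ B) ∧
        (∀ Q' : G, ddist (rt c Q' B) (oflipCM c hc2 s (oflipCM c hc2 s' Ψ)) = bpot c B (oflipCM c hc2 s (oflipCM c hc2 s' Ψ)) →
          rt c Q' B = rt c Q₂ B))) :
    (∀ s ∈ B.1 \ P.1, (2 : ℤ) • ((Finsupp.single (oflipCM c hc2 s B) (1 : ℤ) - Finsupp.single B 1) +
      (Finsupp.single (oflipCM c hc2 s P) (1 : ℤ) - Finsupp.single P 1)) ∈ L) ∧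
    (∀ a ∈ B.1 ∩ P.1, (2 : ℤ) • ((Finsupp.single (oflipCM c hc2 a B) (1 : ℤ) - Finsupp.single B 1) -
      (Finsupp.single (oflipCM c hc2 a P) (1 : ℤ) - Finsupp.single P 1)) ∈ L) ∧
    (∃ T : Finset G, T ⊆ B.1 \ P.1 ∧ T.card = m ∧
      ∑ s ∈ T, Finsupp.single (oflipCM c hc2 s B) (1 : ℤ) - ∑ u ∈ (B.1 \ P.1) \ T, Finsupp.single (oflipCM c hc2 u P) (1 : ℤ) -
        ((m : ℤ) - 1) • (Finsupp.single B (1 : ℤ) - Finsupp.single P 1) ∈ L) ∧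
    (∃ T' : Finset G, T' ⊆ B.1 ∩ P.1 ∧ T'.card = m ∧
      ∑ s ∈ T', Finsupp.single (oflipCM c hc2 s B) (1 : ℤ) + ∑ u ∈ (B.1 ∩ P.1) \ T', Finsupp.single (oflipCM c hc2 u P) (1 : ℤ) -
        ((m : ℤ) - 1) • (Finsupp.single B (1 : ℤ) + Finsupp.single P 1) ∈ L) := by
  have hm1 : 1 ≤ m := by omega
  -- local ties from the far counts of `T` and `T'`
  have htiesT : ∀ U : Finset G, U ⊆ B.1 \ P.1 → U.card = m →
      (∀ t ∈ B.1 \ P.1, ∀ t' ∈ B.1, (t' = t * Q ∨ t' = c * (t * Q)) → (t ∈ U ↔ t' ∉ U)) → (U \ T).card ≤ 1 →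
      ∀ X : CMF G c, B.1 \ X.1 = U → ∀ Q' : G, ddist (rt c Q' B) X = m → rt c Q' B = B ∨ rt c Q' B = P := by
    intro U hUH hUm _ hnear
    refine tie_of_inter_bounds c B 𝒮 hbase m hn hH hc2 hcen hm1 hP𝒮 U hUH hUm fun P₂ hP₂ h12 => ?_
    obtain ⟨⟨h3, h4⟩, -, -, -⟩ := hcfar P₂ hP₂ h12
    exact inter_bounds_of_near T U (B.1 \ P₂.1) m (by rw [hTm, hUm]) hnear h3 h4
  have htiesT'C : ∀ U' : Finset G, U' ⊆ B.1 ∩ P.1 → U'.card = m →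
      (∀ t ∈ B.1 ∩ P.1, ∀ t' ∈ B.1, (t' = t * Q ∨ t' = c * (t * Q)) → (t ∈ U' ↔ t' ∉ U')) → (U' \ T').card ≤ 1 →
      ∀ X : CMF G c, B.1 \ X.1 = U' → ∀ Q' : G, ddist (rt c Q' B) X = m → rt c Q' B = B ∨ rt c Q' B = rt c c P := by
    intro U' hUH hUm _ hnear
    refine tieC_of_inter_bounds c B 𝒮 hbase m hn hH hc2 hcen hm1 hP𝒮 U' hUH hUm fun P₂ hP₂ h12 => ?_
    obtain ⟨-, -, ⟨h3, h4⟩, -⟩ := hcfar P₂ hP₂ h12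
    exact inter_bounds_of_near T' U' (B.1 \ P₂.1) m (by rw [hTm', hUm]) hnear h3 h4
  have htieT := htiesT T hTH hTm hT (by rw [Finset.sdiff_self]; exact Nat.zero_le _)
  have htieT' := htiesT'C T' hTH' hTm' hT' (by rw [Finset.sdiff_self]; exact Nat.zero_le _)
  -- far hypotheses from the counts (as in part LXII, without the global tie counts)
  have hn₁ : P.1.card = 4 * m := card_frame c hc2 B P m hn
  have hn₁c : (rt c c P).1.card = 4 * m := card_frame c hc2 B (rt c c P) m hn
  have hH₁ : ∀ P₂ ∈ 𝒮, P₂ ≠ P → (P.1 \ P₂.1).card = 2 * m := by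
    intro P₂ hP₂ h12
    have e : (P.1 \ P₂.1).card = ddist P P₂ := rfl
    rw [e, ddist_eq_card_symmDiff c B hc2 P P₂]
    exact hpair P hP𝒮 P₂ hP₂ (Ne.symm h12)
  have hH₁c : ∀ P₂ ∈ 𝒮, P₂ ≠ P → ((rt c c P).1 \ P₂.1).card = 2 * m := by
    intro P₂ hP₂ h12
    have e : ((rt c c P).1 \ P₂.1).card = ddist (rt c c P) P₂ := rfl
    rw [e, ddist_compl_eq c B hc2 hcen P P₂, hn, hpair P hP𝒮 P₂ hP₂ (Ne.symm h12)]
    omega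
  have hcW : (((B.1 \ P.1) \ T).image (fun x => c * x)).card = m := by
    rw [card_image_of_injective _ (mul_right_injective c), card_sdiff_of_subset hTH, hH P hP𝒮, hTm]; omega
  have hHcEq : B.1 \ (rt c c P).1 = B.1 ∩ P.1 := by
    rw [dev_compl c hcen B P]; ext t; simp only [mem_sdiff, mem_inter, not_and, not_not]; tauto
  have hcW' : (((B.1 \ (rt c c P).1) \ T').image (fun x => c * x)).card = m := by
    rw [card_image_of_injective _ (mul_right_injective c), hHcEq, card_sdiff_of_subset hTH']
    have h0 := card_sdiff_add_card_inter B.1 P.1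
    have h1 := hH P hP𝒮
    omega
  have hfarT : ∀ a ∈ B.1 ∩ P.1, ∀ a' ∈ B.1, (a' = a * Q ∨ a' = c * (a * Q)) →
      (∀ P₂ ∈ 𝒮, P₂ ≠ P → ∀ X : CMF G c, B.1 \ X.1 ⊆ T ∪ {a, a'} →
        (B.1 \ X.1).card < ddist P₂ X ∧ (B.1 \ X.1).card < ddist (rt c c P₂) X) ∧
      (∀ P₂ ∈ 𝒮, P₂ ≠ P → ∀ X : CMF G c, P.1 \ X.1 ⊆ ((B.1 \ P.1) \ T).image (fun x => c * x) ∪ {a, a'} →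
        (P.1 \ X.1).card < ddist P₂ X ∧ (P.1 \ X.1).card < ddist (rt c c P₂) X) := by
    intro a _ a' _ _
    refine ⟨fun P₂ hP₂ h12 => ?_, fun P₂ hP₂ h12 => ?_⟩
    · obtain ⟨⟨h3, h4⟩, -, -, -⟩ := hcfar P₂ hP₂ h12
      exact far_of_inter_bounds c hc2 hcen B P₂ m hn (hH P₂ hP₂) T hTm h3 h4 a a'
    · obtain ⟨-, ⟨h3, h4⟩, -, -⟩ := hcfar P₂ hP₂ h12
      exact far_of_inter_bounds c hc2 hcen P P₂ m hn₁ (hH₁ P₂ hP₂ h12) _ hcW h3 h4 a a'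
  have hfarT' : ∀ s ∈ B.1 \ P.1, ∀ s' ∈ B.1, (s' = s * Q ∨ s' = c * (s * Q)) →
      (∀ P₂ ∈ 𝒮, P₂ ≠ P → ∀ X : CMF G c, B.1 \ X.1 ⊆ T' ∪ {s, s'} →
        (B.1 \ X.1).card < ddist P₂ X ∧ (B.1 \ X.1).card < ddist (rt c c P₂) X) ∧
      (∀ P₂ ∈ 𝒮, P₂ ≠ P → ∀ X : CMF G c,
        (rt c c P).1 \ X.1 ⊆ ((B.1 \ (rt c c P).1) \ T').image (fun x => c * x) ∪ {s, s'} →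
        ((rt c c P).1 \ X.1).card < ddist P₂ X ∧ ((rt c c P).1 \ X.1).card < ddist (rt c c P₂) X) := by
    intro s _ s' _ _
    refine ⟨fun P₂ hP₂ h12 => ?_, fun P₂ hP₂ h12 => ?_⟩
    · obtain ⟨-, -, ⟨h3, h4⟩, -⟩ := hcfar P₂ hP₂ h12
      exact far_of_inter_bounds c hc2 hcen B P₂ m hn (hH P₂ hP₂) T' hTm' h3 h4 s s'
    · obtain ⟨-, -, -, ⟨h3, h4⟩⟩ := hcfar P₂ hP₂ h12
      exact far_of_inter_bounds c hc2 hcen (rt c c P) P₂ m hn₁c (hH₁c P₂ hP₂ h12) _ hcW' h3 h4 s s'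
  refine ⟨?_, ?_, ?_, ?_⟩
  · exact two_smul_Y_mem_partners_local c hc2 hcen B 𝒮 hbase m hn hH hpair P hP𝒮 Q hQ hQQ hσH L hLrt hPr hcover hm T hTH hTm hT T' hTH' hTm' hT'
      htiesT htieT' hfarT'
  · exact two_smul_Y'_mem_partners_local c hc2 hcen B 𝒮 hbase m hn hH hpair P hP𝒮 Q hQ hQQ hσH L hLrt hPr hcover hm T hTH hTm hT T' hTH' hTm' hT'
      htieT htiesT'C hfarT
  · exact ⟨T, hTH, hTm, rel_transversal_mem_partners c hc2 hcen B 𝒮 hbase m hn hH hpair P hP𝒮 Q hQ hQQ L hLrt hcover (by omega) hσH T hTH hTm hT htieT⟩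
  · exact relc_mem_partners_local c hc2 hcen B 𝒮 hbase m hn hH hpair P hP𝒮 Q hQ hQQ hσH L hLrt hPr hcover (by omega) T' hTH' hTm' hT' htieT'

/-! ## §3 The laws from far counts only -/

/-- **THE ALL-DIHEDRAL MULTI-PARTNER LAW FROM FAR COUNTS** (part LIX without the global tie counts).  Then **`μ(G, c) = φ₂(G, c)`**. [folklore] -/
theorem isLeast_card_gfaces_generate_partners_dihedral_of_far_counts (hG : IsPGroup 2 G) (hc2 : c * c = 1) (hc1 : c ≠ 1)
    (hcen : ∀ x : G, x * c = c * x) (T₀ : CMF G c) (𝒯 : Finset (CMF G c)) (h𝒯 : 𝒯.Nonempty)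
    (hbase : ∀ Q : G, rt c Q T₀ = T₀ ∨ rt c Q T₀ = rt c c T₀ ∨ ∃ T₁ ∈ 𝒯, rt c Q T₀ = T₁ ∨ rt c Q T₀ = rt c c T₁)
    (m : ℕ) (hm : 3 ≤ m) (hn : T₀.1.card = 4 * m) (hH : ∀ T₁ ∈ 𝒯, (T₀.1 \ T₁.1).card = 2 * m)
    (hpair : ∀ T₁ ∈ 𝒯, ∀ T₂ ∈ 𝒯, T₁ ≠ T₂ → ((T₀.1 \ T₁.1) ∆ (T₀.1 \ T₂.1)).card = 2 * m)
    (hframe : ∀ T₁ ∈ 𝒯, ∃ Q : G, ∃ T T' : Finset G,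
      rt c Q T₀ = T₁ ∧ Q * Q = 1 ∧
      (∀ t ∈ T₀.1, ∀ t' ∈ T₀.1, (t' = t * Q ∨ t' = c * (t * Q)) → (t ∈ T₀.1 \ T₁.1 ↔ t' ∈ T₀.1 \ T₁.1)) ∧
      (T ⊆ T₀.1 \ T₁.1 ∧ T.card = m ∧ ∀ t ∈ T₀.1 \ T₁.1, ∀ t' ∈ T₀.1, (t' = t * Q ∨ t' = c * (t * Q)) → (t ∈ T ↔ t' ∉ T)) ∧
      (T' ⊆ T₀.1 ∩ T₁.1 ∧ T'.card = m ∧ ∀ t ∈ T₀.1 ∩ T₁.1, ∀ t' ∈ T₀.1, (t' = t * Q ∨ t' = c * (t * Q)) → (t ∈ T' ↔ t' ∉ T')) ∧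
      (∀ T₂ ∈ 𝒯, T₂ ≠ T₁ →
        (3 ≤ (T ∩ (T₀.1 \ T₂.1)).card ∧ (T ∩ (T₀.1 \ T₂.1)).card + 3 ≤ m) ∧
        (3 ≤ (((T₀.1 \ T₁.1) \ T).image (fun x => c * x) ∩ (T₁.1 \ T₂.1)).card ∧
          (((T₀.1 \ T₁.1) \ T).image (fun x => c * x) ∩ (T₁.1 \ T₂.1)).card + 3 ≤ m) ∧
        (3 ≤ (T' ∩ (T₀.1 \ T₂.1)).card ∧ (T' ∩ (T₀.1 \ T₂.1)).card + 3 ≤ m) ∧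
        (3 ≤ (((T₀.1 \ (rt c c T₁).1) \ T').image (fun x => c * x) ∩ ((rt c c T₁).1 \ T₂.1)).card ∧
          (((T₀.1 \ (rt c c T₁).1) \ T').image (fun x => c * x) ∩ ((rt c c T₁).1 \ T₂.1)).card + 3 ≤ m))) :
    IsLeast {n : ℕ | ∃ S : Finset (CMF G c →₀ ℤ), (↑S ⊆ gfaceSet G c hc2) ∧ S.card = n ∧
      hodgeSpan c hc2 ≤ Submodule.span ℤ (pairSet c) ⊔ Submodule.span ℤ (translates c S)} (fibreTwo c hc2) := by
  refine isLeast_card_gfaces_generate_of_strict_cover_closure c T₀ hG hc2 hc1 hcen 1 fun S hS hlow => ?_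
  have hP : ∀ Ψ : CMF G c, pair c Ψ ∈ Submodule.span ℤ (pairSet c) ⊔ Submodule.span ℤ (translates c S) :=
    fun Ψ => Submodule.mem_sup_left (Submodule.subset_span (pair_mem_pairSet c Ψ))
  have hLrt : ∀ (Q' : G) (y : CMF G c →₀ ℤ), y ∈ Submodule.span ℤ (pairSet c) ⊔ Submodule.span ℤ (translates c S) →
      Finsupp.mapDomain (rt c Q') y ∈ Submodule.span ℤ (pairSet c) ⊔ Submodule.span ℤ (translates c S) :=
    fun Q' y hy => mapDomain_rt_mem_psp c hcen Q' S hy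
  have hcover : ∀ Ψ : CMF G c, 2 ≤ bpot c T₀ Ψ → ∃ Q₂ s s' : G, bpot c T₀ Ψ = ddist (rt c Q₂ T₀) Ψ ∧
      s ∈ (rt c Q₂ T₀).1 \ Ψ.1 ∧ s' ∈ (rt c Q₂ T₀).1 \ Ψ.1 ∧ s ≠ s' ∧
      gface c hc2 Ψ s s' ∈ Submodule.span ℤ (pairSet c) ⊔ Submodule.span ℤ (translates c S) ∧
      ((∃ Q₁ t t' : G, bpot c T₀ Ψ = ddist (rt c Q₁ T₀) Ψ ∧ t ∈ (rt c Q₁ T₀).1 \ Ψ.1 ∧ t' ∈ (rt c Q₁ T₀).1 \ Ψ.1 ∧ t ≠ t' ∧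
          (∀ Q' : G, ddist (rt c Q' T₀) (oflipCM c hc2 t Ψ) = bpot c T₀ (oflipCM c hc2 t Ψ) → rt c Q' T₀ = rt c Q₁ T₀) ∧
          (∀ Q' : G, ddist (rt c Q' T₀) (oflipCM c hc2 t' Ψ) = bpot c T₀ (oflipCM c hc2 t' Ψ) → rt c Q' T₀ = rt c Q₁ T₀) ∧
          (∀ Q' : G, ddist (rt c Q' T₀) (oflipCM c hc2 t (oflipCM c hc2 t' Ψ)) = bpot c T₀ (oflipCM c hc2 t (oflipCM c hc2 t' Ψ)) →
            rt c Q' T₀ = rt c Q₁ T₀)) →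
        (∀ Q' : G, ddist (rt c Q' T₀) (oflipCM c hc2 s Ψ) = bpot c T₀ (oflipCM c hc2 s Ψ) → rt c Q' T₀ = rt c Q₂ T₀) ∧
        (∀ Q' : G, ddist (rt c Q' T₀) (oflipCM c hc2 s' Ψ) = bpot c T₀ (oflipCM c hc2 s' Ψ) → rt c Q' T₀ = rt c Q₂ T₀) ∧
        (∀ Q' : G, ddist (rt c Q' T₀) (oflipCM c hc2 s (oflipCM c hc2 s' Ψ)) = bpot c T₀ (oflipCM c hc2 s (oflipCM c hc2 s' Ψ)) →
          rt c Q' T₀ = rt c Q₂ T₀)) := fun Ψ h2 => by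
    obtain ⟨Q₂, s, s', hQ₂, hs, hs', hss', hmem, hstr⟩ := hlow Ψ h2
    exact ⟨Q₂, s, s', hQ₂, hs, hs', hss', Submodule.mem_sup_right hmem, hstr⟩
  have hHc : ∀ T₁ ∈ 𝒯, (T₀.1 ∩ T₁.1).card = 2 * m := by
    intro T₁ hT₁
    have h0 := card_sdiff_add_card_inter T₀.1 T₁.1
    have h1 := hH T₁ hT₁
    omega
  refine residual_closure_partners_bpot c hc2 hc1 hcen T₀ 𝒯 h𝒯 hbase _ hP 1 m hH hHc ?_ ?_ ?_ ?_
  · intro T₁ hT₁ s hs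
    obtain ⟨Q, T, T', hQ, hQQ, hσH, ⟨hTH, hTm, hT⟩, ⟨hTH', hTm', hT'⟩, hcfar⟩ := hframe T₁ hT₁
    rw [pow_one]
    exact (partner_families_of_far_counts c hc2 hcen T₀ 𝒯 hbase m hm hn hH hpair hT₁ Q hQ hQQ hσH T T' hTH hTm hT hTH' hTm' hT' hcfar _ hLrt hP
      hcover).1 s hs
  · intro T₁ hT₁ a ha
    obtain ⟨Q, T, T', hQ, hQQ, hσH, ⟨hTH, hTm, hT⟩, ⟨hTH', hTm', hT'⟩, hcfar⟩ := hframe T₁ hT₁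
    rw [pow_one]
    exact (partner_families_of_far_counts c hc2 hcen T₀ 𝒯 hbase m hm hn hH hpair hT₁ Q hQ hQQ hσH T T' hTH hTm hT hTH' hTm' hT' hcfar _ hLrt hP
      hcover).2.1 a ha
  · intro T₁ hT₁
    obtain ⟨Q, T, T', hQ, hQQ, hσH, ⟨hTH, hTm, hT⟩, ⟨hTH', hTm', hT'⟩, hcfar⟩ := hframe T₁ hT₁
    exact (partner_families_of_far_counts c hc2 hcen T₀ 𝒯 hbase m hm hn hH hpair hT₁ Q hQ hQQ hσH T T' hTH hTm hT hTH' hTm' hT' hcfar _ hLrt hP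
      hcover).2.2.1
  · intro T₁ hT₁
    obtain ⟨Q, T, T', hQ, hQQ, hσH, ⟨hTH, hTm, hT⟩, ⟨hTH', hTm', hT'⟩, hcfar⟩ := hframe T₁ hT₁
    exact (partner_families_of_far_counts c hc2 hcen T₀ 𝒯 hbase m hm hn hH hpair hT₁ Q hQ hQQ hσH T T' hTH hTm hT hTH' hTm' hT' hcfar _ hLrt hP
      hcover).2.2.2

end

end Summit.HodgeConjecture.CorCM.Census.CentralSquares
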